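import Literature.MathematicalPhysics.QuantumFieldTheory.Balaban1983to89.B5Eq115GaugeChain

/-!
# `Balaban1983to89.B5Eq120TowerGauge` — T. Bałaban, *Propagators and renormalization transformations for lattice
# gauge theories. I*, Commun. Math. Phys. **95** (1984) 17–40 [Balaban1984PropagatorsI]: (1.20) p. 20 «Q_kA^λ = Q_kA −
# ∂Q′_kλ» for the COMPOSITE averages `Q_k = Q∘⋯∘Q` of (1.16)–(1.17), the p. 20 sentence «δ(B − Q_kA) is invariant with
# respect to gauge transformations λ satisfying Q′_kλ = 0», and the argument of (1.15) run on (1.17): the k-fold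
# transformation and the form ⟨B, Δ_kB⟩ of (1.19) are gauge invariant — PROVED on r02's tower carrier

statement-level skeleton of published theorems with citation tags; proofs where landed; nothing here is a claim about the Yang–Mills mass gap

PDF held: `paper:balaban1984-cmp95-propagators-rt-i` (journal page = PDF page + 16); pp. 19–20 [PDF 3–4] read AS IMAGES
(renders `run/shared/lean/pub/pub-balaban/b2b-balaban-ref1/pages/1984-cmp95-propagators-rt-I/…-p003-x2.png`, `…-p004-x2.png`).

CITATION HEADER (lean-in-tree rule).  Cell `lit-balaban` (HOME `run/shared/lean/pub/lit-balaban/`), Phase-2 proof seat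
`lit-balaban-p21` gen 3; companion of `B5Eq115GaugeChain` (this seat: (1.15) for the one-step Δ₁ of (1.14)), which is
IMPORTED.  WHAT IS REPRODUCED = knitting for SKELETON rows `B5.Eq1.9-1.20` (r18; (1.20) — proved on the V1 calculus by
seat p38, `B5Eq120IterProof`, and as the one-stroke matrix identity `B5Block118.QvOp_gaugeT`; HERE: for r02's COMPOSITE
`B5SectBStatements.Qk/Qsk` down the tower `towerM L M k`, the objects entering the typed (1.17)/(1.19)/(1.22)/(1.23)),
`B5.Eq1.17`/`B5.Eq1.19` (r02, proved p245722: `rt17`, `DeltaK`; HERE: their gauge covariance/invariance, the (1.15)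
sentence *"The form ⟨B, Δ₁B⟩ is gauge invariant"* for every `k`).  No statement of those files is restated; r02's
`B5SectBStatements`/`B5Eq114Gauss` are imported unchanged (through `B5Eq115GaugeChain`).

WHAT IS PRINTED (p. 20 [PDF 4], verbatim).  «((ST)^k e^{−S})(B) = z^{(k)} ∫dAδ(B − Q_kA)δ_Ax(Q_{k−1}A)·…·δ_Ax(A)e^{−S^η(A)},
(1.17)»; «We define ((ST)^k e^{−S})(B) = Z_{k,Ax} exp(−½⟨B, Δ_kB⟩). (1.19)»; «Under a gauge transformation λ the field A and
the averaged field Q_kA transform as follows A^λ = A − ∂^ηλ, (Q_kA^λ)_b = (Q_kA)_b − (Σ_{x∈B^k(b₊)} η^dλ(x) − Σ_{x∈B^k(b₋)}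
η^dλ(x)), b ⊂ T₁^{(k)}, (1.20) or denoting (Q′_kλ)(y) = Σ_{x∈B^k(y)} η^dλ(x), we have Q_kA^λ = Q_kA − ∂Q′_kλ.  The δ-function
δ(B − Q_kA) is invariant with respect to gauge transformations λ satisfying Q′_kλ = 0 and we can look at the integral (1.17)
as obtained by removing this gauge freedom by the help of the δ-functions δ_Ax.»; p. 19: «The form ⟨B, Δ₁B⟩ is gauge
invariant. If λ₁ is a gauge transformation on T_L^{(1)}, then defining λ on T₁ as constant on each block … (1.15)».

WHAT THIS FILE PROVES (0 sorry, 0 new `def … : Prop`, axioms ⊆ {propext, Classical.choice, Quot.sound}).  One definition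
with body: `liftK k λ₁` = the k-fold block-constant extension of a gauge function of the unit lattice `T₁^{(k)}` to the
finest lattice of the tower («λ constant on each block», iterated).  §1 (1.20): r02's «A^λ = A − ∂^ηλ» (`gaugeR L M k`, factor
`η⁻¹ = L^k`) is `A − L^k·gradR λ` (`gaugeR_eq`); one level down the tower «Q(A − L^{j+1}∂λ) = QA − L^j∂(Q′λ)»
(`Qlin_gaugeR`, from `B5Eq115GaugeChain.Qlin_gradR`); by induction **`Qk_gaugeR : Q_k(A^λ) = (Q_kA) − ∂(Q′_kλ)`** (the
printed (1.20) for the composites) and the p. 20 sentence **`Qk_gaugeR_of_Qsk_eq_zero : Q′_kλ = 0 ⇒ Q_kA^λ = Q_kA`**.  §2 the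
block-constant tower gauge functions: `Q′_k(liftK k λ₁) = λ₁` (`Qsk_liftK`), `Q_k(∂ liftK k λ₁) = L^{−k}∂λ₁` (`Qk_gradR_liftK`),
the hierarchical axial gauge of (1.17) is invariant under them (`gaugeR_liftK_mem_AxAll`, level by level from
`B5Eq115GaugeChain.gradR_blockConst_mem_Ax`), «S^η(A^λ) = S^η(A)» (`actionEta_gaugeR` ← `B5Action121.actionS_gaugeT`).
§3 the (1.15) argument on (1.17): **`rt17_gauge : ∫dA δ(B^{λ₁} − Q_kA)δ_Ax⋯δ_Ax e^{−S^η(A)} = (same at B)`**, `B^{λ₁} =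
B − ∂λ₁` on the unit lattice (translation invariance `B5Eq115GaugeChain.deltaInt_translate`), hence
**`iterST_gauge : ((ST)^k e^{−S})(B^{λ₁}) = ((ST)^k e^{−S})(B)`** (d ≥ 2, through r02's (1.17) `eq117_holds`) and, for the
`Δ_k` DEFINED by (1.19) (`B5Eq114Gauss.DeltaK`, r02's `rt17_gauss`/`Zk_pos`), **`inner_DeltaK_gauge : ⟨B^{λ₁}, Δ_kB^{λ₁}⟩ =
⟨B, Δ_kB⟩`**, `DeltaK_gradR : Δ_k(∂λ₁) = 0`, `DeltaK_gauge : Δ_kB^{λ₁} = Δ_kB` (d ≥ 2).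

HONEST SCOPE.  (i) Every `L ≥ 1`, every torus `M`, every `k`; U = 1 (the paper's Sect. 1).  (ii) `Q_k`, `Q′_k` are r02's
COMPOSITES down the tower (the one-stroke identification (1.18) is row B5.Eq1.11-1.18, not used here); (1.20) is proved
for them by induction from the one-level (1.13).  (iii) The gauge functions of §2–§3 are the block-constant extensions of
unit-lattice gauge functions — the ones the (1.15) argument uses; general λ with `Q′_kλ = λ₁` are not needed and not
treated.  (iv) `iterST_gauge`, `inner_DeltaK_gauge`, `DeltaK_gradR`, `DeltaK_gauge` carry `2 ≤ d` exactly as r02's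
`eq117_holds`/`Zk_pos`; `rt17_gauge` and §1–§2 carry no hypothesis.  Value = kernel certificates of the printed gauge
structure of (1.17)/(1.19)/(1.20) on the carrier of record; NOT summit progress.
-/

open scoped BigOperators Matrix
open Finset MeasureTheory

namespace Literature.MathematicalPhysics.QuantumFieldTheory.Balaban1983to89.B5Eq120TowerGauge

open B5Prop11Plancherel (Tor fine unitVec)
open B5Block118 (bpt tstep)
open B5Action121 (actionS gaugeT GradOp)
open B5SectBStatements
open B5Eq114Gauss (Zk DeltaK Wk rt17_gauss Zk_pos inner_DeltaK eq117_holds)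
open B5Eq115GaugeChain

noncomputable section

/-! ## §1  (1.20) for the composite averages `Q_k`, `Q′_k` of the tower -/

section Law

variable {d : ℕ} (L : ℕ) (M : Fin d → ℕ)

/-- r02's «A^λ = A − ∂^ηλ» at level `k` (lattice factor `η⁻¹ = L^k`) is `A − L^k·(∂λ)` with the unit-factor gradient `gradR`
of `B5Eq115GaugeChain`. [cite: Balaban1984PropagatorsI, (1.20) p.20] -/
theorem gaugeR_eq (k : ℕ) (A : Fld (towerM L M k)) (l : Scl (towerM L M k)) :
    gaugeR L M k A l = A - ((L : ℝ) ^ k) • gradR l := by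
  ext i
  obtain ⟨x, ν⟩ := i
  simp only [gaugeR, PiLp.toLp_apply, PiLp.sub_apply, PiLp.smul_apply, gradR_apply, smul_eq_mul]

/-- the same one level up, with the finer lattice written as `fine L (towerM L M j)` (the form in which the one-level
operators `Qlin`/`QsLin`/`Ax` of `B5SectBStatements` act). [cite: Balaban1984PropagatorsI, (1.20) p.20] -/
theorem gaugeR_succ_eq (j : ℕ) (A : Fld (fine L (towerM L M j))) (l : Scl (fine L (towerM L M j))) :
    gaugeR L M (j + 1) A l = A - ((L : ℝ) ^ (j + 1)) • gradR l :=
  gaugeR_eq L M (j + 1) A l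

/-- on the unit lattice `T₁^{(k)}` (level `0`, factor `1`): «B^{λ₁} = B − ∂λ₁». [cite: Balaban1984PropagatorsI, (1.20) p.20] -/
theorem gaugeR_zero_eq (B : Fld M) (l₁ : Scl M) : gaugeR L M 0 B l₁ = B - gradR l₁ := by
  rw [gaugeR_eq, pow_zero, one_smul]
  rfl

/-- `∂0 = 0`. [cite: Balaban1984PropagatorsI, (1.4) p.18] -/
theorem gradR_zero {N : Fin d → ℕ} : gradR (0 : Scl N) = 0 := by
  ext i
  obtain ⟨x, ν⟩ := i
  simp [gradR_apply]

variable [NeZero L]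

/-- **(1.20), one level of the tower**: «Q(A − L^{j+1}∂λ) = QA − L^j∂(Q′λ)» — the one-step law (1.13) (`Qlin_gradR`: `Q∂ =
L^{−1}∂Q′` at unit factors) with the lattice factors `L^{j+1}` (level `j + 1`) and `L^j` (level `j`).
[cite: Balaban1984PropagatorsI, (1.20) p.20] -/
theorem Qlin_gaugeR (j : ℕ) (A : Fld (fine L (towerM L M j))) (l : Scl (fine L (towerM L M j))) :
    Qlin L (towerM L M j) (gaugeR L M (j + 1) A l)
      = gaugeR L M j (Qlin L (towerM L M j) A) (QsLin L (towerM L M j) l) := by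
  have hL : (L : ℝ) ≠ 0 := by exact_mod_cast NeZero.ne L
  rw [gaugeR_succ_eq, gaugeR_eq, map_sub, map_smul, Qlin_gradR, smul_smul, pow_succ, mul_assoc, mul_inv_cancel₀ hL,
    mul_one]

/-- **(1.20) for the composites `Q_k = Q∘⋯∘Q`, `Q′_k`** (p. 20: «we have Q_kA^λ = Q_kA − ∂Q′_kλ»): the average on the unit
lattice of the transformed finest field is the unit-lattice transform of the average by `Q′_kλ` — by induction down the
tower. [cite: Balaban1984PropagatorsI, (1.20) p.20] -/
theorem Qk_gaugeR : ∀ (k : ℕ) (A : Fld (towerM L M k)) (l : Scl (towerM L M k)),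
    Qk L M k (gaugeR L M k A l) = gaugeR L M 0 (Qk L M k A) (Qsk L M k l)
  | 0, _, _ => rfl
  | k + 1, A, l => by
      have h1 := Qlin_gaugeR L M k A l
      have h2 := Qk_gaugeR k (Qlin L (towerM L M k) A) (QsLin L (towerM L M k) l)
      show Qk L M k (Qlin L (towerM L M k) (gaugeR L M (k + 1) A l))
        = gaugeR L M 0 (Qk L M k (Qlin L (towerM L M k) A)) (Qsk L M k (QsLin L (towerM L M k) l))
      rw [h1, h2]

/-- **p. 20, verbatim: *"The δ-function δ(B − Q_kA) is invariant with respect to gauge transformations λ satisfying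
Q′_kλ = 0"*** — `Q′_kλ = 0 ⇒ Q_kA^λ = Q_kA`. [cite: Balaban1984PropagatorsI, (1.20) p.20] -/
theorem Qk_gaugeR_of_Qsk_eq_zero (k : ℕ) (A : Fld (towerM L M k)) (l : Scl (towerM L M k)) (hl : Qsk L M k l = 0) :
    Qk L M k (gaugeR L M k A l) = Qk L M k A := by
  rw [Qk_gaugeR, hl, gaugeR_zero_eq, gradR_zero, sub_zero]

end Law

/-! ## §2  Block-constant gauge functions down the tower; invariance of the hierarchical axial gauge and of `S^η` -/

section Lift

variable {d : ℕ}

/-- the axial gauge (1.10) is blind to pure gauges of block-constant gauge functions, with any factor: `A − c·∂λ ∈ Ax ↔ A ∈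
Ax` for `λ` constant on blocks (`B5Eq115GaugeChain.gradR_blockConst_mem_Ax`). [cite: Balaban1984PropagatorsI, (1.10) p.19] -/
theorem sub_smul_gradR_blockConst_mem_Ax_iff (n : ℕ) [NeZero n] (M : Fin d → ℕ) [∀ μ, NeZero (M μ)]
    (A : Fld (fine n M)) (c : ℝ) (l₁ : Scl M) :
    A - c • gradR (blockConst n M l₁) ∈ Ax n M ↔ A ∈ Ax n M := by
  have h := (Ax n M).smul_mem c (gradR_blockConst_mem_Ax n M l₁)
  exact ⟨fun hA => by simpa using (Ax n M).add_mem hA h, fun hA => (Ax n M).sub_mem hA h⟩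

variable (L : ℕ) [NeZero L] (M : Fin d → ℕ) [hM : ∀ μ, NeZero (M μ)]

/-- **the k-fold block-constant extension** of a gauge function `λ₁` of the unit lattice `T₁^{(k)}` to level `k` of the
tower: «λ(x) = λ₁(y) for x∈B(y)» applied level by level (so `λ(x) = λ₁(y)` for `x ∈ B^k(y)`).
[cite: Balaban1984PropagatorsI, (1.15) p.19] -/
def liftK : (k : ℕ) → Scl M → Scl (towerM L M k)
  | 0 => fun l₁ => l₁
  | k + 1 => fun l₁ => blockConst L (towerM L M k) (liftK k l₁)

/-- level `0`: the extension is `λ₁` itself. [cite: Balaban1984PropagatorsI, (1.15) p.19] -/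
theorem liftK_zero (l₁ : Scl M) : liftK L M 0 l₁ = l₁ := rfl

/-- level `k + 1`: the block-constant extension of the level-`k` extension. [cite: Balaban1984PropagatorsI, (1.15) p.19] -/
theorem liftK_succ (k : ℕ) (l₁ : Scl M) : liftK L M (k + 1) l₁ = blockConst L (towerM L M k) (liftK L M k l₁) := rfl

/-- **`Q′_k λ = λ₁`** for the k-fold block-constant extension (level by level `Q′λ = λ₁`, `QsLin_blockConst`).
[cite: Balaban1984PropagatorsI, (1.20) p.20] -/
theorem Qsk_liftK : ∀ (k : ℕ) (l₁ : Scl M), Qsk L M k (liftK L M k l₁) = l₁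
  | 0, _ => rfl
  | k + 1, l₁ => by
      show Qsk L M k (QsLin L (towerM L M k) (blockConst L (towerM L M k) (liftK L M k l₁))) = l₁
      rw [QsLin_blockConst]
      exact Qsk_liftK k l₁

/-- `Q_k(∂λ) = L^{−k}·∂λ₁` for the k-fold block-constant extension `λ` of `λ₁` (level by level `Q∂ = L^{−1}∂Q′`, (1.13)).
[cite: Balaban1984PropagatorsI, (1.20) p.20] -/
theorem Qk_gradR_liftK : ∀ (k : ℕ) (l₁ : Scl M), Qk L M k (gradR (liftK L M k l₁)) = ((L : ℝ) ^ k)⁻¹ • gradR l₁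
  | 0, l₁ => by
      rw [pow_zero, inv_one, one_smul]
      rfl
  | k + 1, l₁ => by
      show Qk L M k (Qlin L (towerM L M k) (gradR (blockConst L (towerM L M k) (liftK L M k l₁))))
        = ((L : ℝ) ^ (k + 1))⁻¹ • gradR l₁
      rw [Qlin_gradR, QsLin_blockConst, map_smul, Qk_gradR_liftK k l₁, smul_smul]
      congr 1
      rw [pow_succ, mul_inv, mul_comm]

omit hM in
/-- membership in the level-`k+1` hierarchical axial subspace, on the carrier `Fld (fine L (towerM L M k))` to which
`Fld (towerM L M (k+1))` and `AxAll L M (k+1)` reduce (r02's `axAll_succ`): «A axial and QA hierarchically axial».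
[cite: Balaban1984PropagatorsI, (1.17) p.20] -/
theorem mem_axAll_succ (k : ℕ) (A : Fld (fine L (towerM L M k))) :
    A ∈ AxAll L M (k + 1) ↔ A ∈ Ax L (towerM L M k) ∧ Qlin L (towerM L M k) A ∈ AxAll L M k := by
  show A ∈ Ax L (towerM L M k) ⊓ (AxAll L M k).comap (Qlin L (towerM L M k)) ↔ _
  rw [Submodule.mem_inf, Submodule.mem_comap]

/-- **the hierarchical axial gauge of (1.17) is gauge invariant under block-constant gauge functions**: `A^λ` (λ the
k-fold extension of `λ₁`, any `A` of level `k`) satisfies «A, QA, …, Q_{k−1}A axial» iff `A` does — level by level: the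
contours of (1.7) stay inside their blocks (`gradR_blockConst_mem_Ax`) and `QA^λ = (QA)^{Q′λ}` (1.20) with `Q′λ` again
block-constant. [cite: Balaban1984PropagatorsI, (1.17) p.20] -/
theorem gaugeR_liftK_mem_AxAll : ∀ (k : ℕ) (A : Fld (towerM L M k)) (l₁ : Scl M),
    gaugeR L M k A (liftK L M k l₁) ∈ AxAll L M k ↔ A ∈ AxAll L M k
  | 0, A, l₁ => by
      show gaugeR L M 0 A (liftK L M 0 l₁) ∈ (⊤ : Submodule ℝ (Fld (towerM L M 0))) ↔ A ∈ (⊤ : Submodule ℝ _)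
      simp only [Submodule.mem_top]
  | k + 1, A, l₁ => by
      have e := gaugeR_succ_eq L M k A (blockConst L (towerM L M k) (liftK L M k l₁))
      have h1 : gaugeR L M (k + 1) A (liftK L M (k + 1) l₁) ∈ Ax L (towerM L M k) ↔ A ∈ Ax L (towerM L M k) := by
        rw [liftK_succ, e]
        exact sub_smul_gradR_blockConst_mem_Ax_iff L (towerM L M k) A _ (liftK L M k l₁)
      have h2 : Qlin L (towerM L M k) (gaugeR L M (k + 1) A (liftK L M (k + 1) l₁))
          = gaugeR L M k (Qlin L (towerM L M k) A) (liftK L M k l₁) := by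
        rw [liftK_succ, Qlin_gaugeR, QsLin_blockConst]
      have h3 : Qlin L (towerM L M k) (gaugeR L M (k + 1) A (liftK L M (k + 1) l₁)) ∈ AxAll L M k
          ↔ Qlin L (towerM L M k) A ∈ AxAll L M k := by
        rw [h2]
        exact gaugeR_liftK_mem_AxAll k _ l₁
      exact Iff.trans (mem_axAll_succ L M k _) (Iff.trans (and_congr h1 h3) (mem_axAll_succ L M k A).symm)

/-- the pure gauge `L^k·∂λ` of the k-fold block-constant extension is itself hierarchically axial.
[cite: Balaban1984PropagatorsI, (1.17) p.20] -/
theorem smul_gradR_liftK_mem_AxAll (k : ℕ) (l₁ : Scl M) :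
    ((L : ℝ) ^ k) • gradR (liftK L M k l₁) ∈ AxAll L M k := by
  have h := (gaugeR_liftK_mem_AxAll L M k (((L : ℝ) ^ k) • gradR (liftK L M k l₁)) l₁).mp
  rw [gaugeR_eq, sub_self] at h
  exact h (zero_mem _)

/-- **«S^η(A^λ) = S^η(A)»**: the η-lattice action of (1.17) is gauge invariant (tree: `B5Action121.actionS_gaugeT` through
r02's dictionary `cplx_gaugeR`). [cite: Balaban1984PropagatorsI, (1.17) p.20] -/
theorem actionEta_gaugeR (k : ℕ) (A : Fld (towerM L M k)) (l : Scl (towerM L M k)) :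
    actionEta L M k (gaugeR L M k A l) = actionEta L M k A := by
  unfold actionEta
  rw [cplx_gaugeR, B5Action121.actionS_gaugeT]

end Lift

/-! ## §3  The (1.15) argument on (1.17): gauge covariance of the k-fold transformation, invariance of `⟨B, Δ_kB⟩` -/

section Invariance

variable {d : ℕ} (L : ℕ) [NeZero L] (M : Fin d → ℕ) [hM : ∀ μ, NeZero (M μ)]

/-- **The integral (1.17) is gauge covariant**: `∫dA δ(B^{λ₁} − Q_kA)δ_Ax(Q_{k−1}A)⋯δ_Ax(A)e^{−S^η(A)} = (the same at B)`,
`B^{λ₁} = B − ∂λ₁` on the unit lattice — the (1.15) argument: translate `A → A^λ` by the pure gauge of the k-fold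
block-constant extension of `λ₁` (`deltaInt_translate`; it is hierarchically axial), use «S^η(A^λ) = S^η(A)», (1.20)
`Q_kA^λ = Q_kA − ∂Q′_kλ` and `Q′_kλ = λ₁`. [cite: Balaban1984PropagatorsI, (1.17) p.20] -/
theorem rt17_gauge (k : ℕ) (B : Fld M) (l₁ : Scl M) : rt17 L M k (B - gradR l₁) = rt17 L M k B := by
  have hLk : ((L : ℝ) ^ k) ≠ 0 := pow_ne_zero k (by exact_mod_cast NeZero.ne L)
  have hv := smul_gradR_liftK_mem_AxAll L M k l₁
  have hQ : B - gradR l₁ + Qk L M k (((L : ℝ) ^ k) • gradR (liftK L M k l₁)) = B := by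
    rw [map_smul, Qk_gradR_liftK, smul_smul, mul_inv_cancel₀ hLk, one_smul, sub_add_cancel]
  have hρ : ∀ A : Fld (towerM L M k),
      Real.exp (-actionEta L M k (A - ((L : ℝ) ^ k) • gradR (liftK L M k l₁))) = Real.exp (-actionEta L M k A) := by
    intro A
    rw [← gaugeR_eq L M k A (liftK L M k l₁), actionEta_gaugeR]
  unfold rt17
  rw [← deltaInt_translate (Qk L M k) (AxAll L M k) (fun A => Real.exp (-actionEta L M k A)) (B - gradR l₁) hv, hQ]
  simp only [hρ]

/-- hence **the k-fold renormalization transformation is gauge covariant**: `((ST)^k e^{−S})(B^{λ₁}) = ((ST)^k e^{−S})(B)`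
(d ≥ 2, through r02's (1.17) `B5Eq114Gauss.eq117_holds`). [cite: Balaban1984PropagatorsI, (1.17) p.20] -/
theorem iterST_gauge (hd : 2 ≤ d) (k : ℕ) (B : Fld M) (l₁ : Scl M) :
    iterST L M k (fun A => Real.exp (-action1 A)) (B - gradR l₁) = iterST L M k (fun A => Real.exp (-action1 A)) B := by
  obtain ⟨z, -, hz⟩ := eq117_holds L M hd k
  rw [hz, hz, rt17_gauge]

/-- **«The form ⟨B, Δ_kB⟩ is gauge invariant»** for the `Δ_k` DEFINED by (1.19) (`B5Eq114Gauss.DeltaK`): `⟨B^{λ₁}, Δ_kB^{λ₁}⟩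
= ⟨B, Δ_kB⟩`, `B^{λ₁} = B − ∂λ₁`, every `k`, every `B`, every gauge function `λ₁` of `T₁^{(k)}` (d ≥ 2 via `Zk_pos`: `Z^{(k)} >
0` lets the Gaussian values `rt17_gauss` determine the form) — the (1.15) sentence for every `k`.
[cite: Balaban1984PropagatorsI, (1.15) p.19] -/
theorem inner_DeltaK_gauge (hd : 2 ≤ d) (k : ℕ) (B : Fld M) (l₁ : Scl M) :
    inner ℝ (B - gradR l₁) (DeltaK L M k (B - gradR l₁)) = inner ℝ B (DeltaK L M k B) := by
  have hZ : Zk L M k ≠ 0 := (Zk_pos L M hd k).ne'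
  have h := rt17_gauge L M k B l₁
  rw [rt17_gauss, rt17_gauss] at h
  have h2 := Real.exp_injective (mul_left_cancel₀ hZ h)
  simp only [S1, neg_inj] at h2
  linarith

/-- operator form: **`Δ_k(∂λ₁) = 0`** — at `B = ∂λ₁` (so `B^{λ₁} = 0`), `0 = ⟨B, Δ_kB⟩ = ‖W_kB‖²` (`inner_DeltaK`), hence
`W_kB = 0` and `Δ_kB = W_k^†W_kB = 0`. [cite: Balaban1984PropagatorsI, (1.19) p.20] -/
theorem DeltaK_gradR (hd : 2 ≤ d) (k : ℕ) (l₁ : Scl M) : DeltaK L M k (gradR l₁) = 0 := by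
  have h := inner_DeltaK_gauge L M hd k (gradR l₁) l₁
  rw [sub_self, map_zero, inner_zero_right, inner_DeltaK] at h
  have hW : Wk L M k (gradR l₁) = 0 := norm_eq_zero.mp (pow_eq_zero_iff two_ne_zero |>.mp h.symm)
  show (LinearMap.adjoint (Wk L M k) ∘ₗ Wk L M k) (gradR l₁) = 0
  rw [LinearMap.comp_apply, hW, map_zero]

/-- hence **`Δ_kB^{λ₁} = Δ_kB`**. [cite: Balaban1984PropagatorsI, (1.19) p.20] -/
theorem DeltaK_gauge (hd : 2 ≤ d) (k : ℕ) (B : Fld M) (l₁ : Scl M) :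
    DeltaK L M k (B - gradR l₁) = DeltaK L M k B := by
  rw [map_sub, DeltaK_gradR L M hd, sub_zero]

/-- the same statements with r02's level-`0` transformation `gaugeR L M 0` («B^{λ₁} = B − ∂λ₁» on `T₁^{(k)}`):
`((ST)^k e^{−S})(gaugeR 0 B λ₁) = ((ST)^k e^{−S})(B)`. [cite: Balaban1984PropagatorsI, (1.17) p.20] -/
theorem iterST_gaugeR (hd : 2 ≤ d) (k : ℕ) (B : Fld M) (l₁ : Scl M) :
    iterST L M k (fun A => Real.exp (-action1 A)) (gaugeR L M 0 B l₁)
      = iterST L M k (fun A => Real.exp (-action1 A)) B := by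
  rw [gaugeR_zero_eq, iterST_gauge L M hd]

end Invariance

end

end Literature.MathematicalPhysics.QuantumFieldTheory.Balaban1983to89.B5Eq120TowerGauge
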